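import Summits.CriticalPhenomena.PercolationContinuityZ3.Theorems.Transplant.ThetaContinuousCatalogue
import Summits.CriticalPhenomena.PercolationContinuityZ3.Theorems.Transplant.BoxProdZ2AllFibres
import HarnessLib

/-!
# `p ↦ θ(v, p)` is CONTINUOUS on `[0, 1]` at every vertex of `F □ ℤ^d` and `ℤ^d □ F` for every FINITE connected `F` and every `d ≥ 2` — the slabs
# `ℤ^d × {0,…,k}` of every thickness in every dimension `≥ 3`, `ℤ^d × C_n`, `ℤ^d × K_m`, … (the Duminil-Copin–Sidoravicius–Tassion-type rows)

builds on p205010 (kernel theorem, internal audit signed; external expert review pending) — through the product node (`BoxProdZ2.bsConj4_boxProdZd_all`).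
Lane `prim-bschramm`, class C1b, seat `prim-bschramm-p2` gen 15; helper file (`--supports stmt-CriticalPhenomena-4575`).  Memo `HOME/bschramm/P2-LATTICES.md` §40.
Continuation of `Transplant/ThetaContinuousCatalogue.lean` (§5 `continuous_theta_boxProdZd` for `X □ ℤ^d`, `X` of subexponential growth): a finite connected `F` is
quasi-transitive (`BoxProdZ2.isQuasiTransitive_of_finite`) and has no exponential growth (`BoxProdZ2.not_hasExponentialGrowth_of_finite`), so §5 applies; the
factor order `ℤ^d □ F` (the tree's `zdGraph d □ F` of rung R1 / `ZdTimesFiniteOwnCriticalContinuity`) is reached through Mathlib's `SimpleGraph.boxProdComm`.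
* `continuous_theta_finiteBoxProdZd` (`F □ ℤ^d`), **`continuous_theta_zdTimesFinite`** (`ℤ^d □ F`), every vertex, every `d ≥ 2`.
[cite: VandenBergKeane1984, Theorem] [cite: DuminilCopinSidoraviciusTassion2016, §1 ("Two generalizations")] [cite: BenjaminiSchramm1996, Conj. 4]
-/

noncomputable section

namespace Summit.CriticalPhenomena.PercolationContinuityZ3.Theorems.Transplant

namespace ThetaCont

open MeasureTheory Literature.Probability.Percolation Literature.Probability.LatticeModels SimpleGraph
open Literature.Barriers.CriticalPhenomena (countable_of_connected_of_locallyFinite zdGraph_connected)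

/-- **`p ↦ θ_{F □ ℤ^d}(v, p)` is continuous on `[0, 1]`** for every finite connected `F`, every `d ≥ 2`, every vertex — builds on p205010 (kernel theorem,
internal audit signed; external expert review pending). [cite: VandenBergKeane1984, Theorem] [cite: BenjaminiSchramm1996, Conj. 4] -/
theorem continuous_theta_finiteBoxProdZd {W : Type} [Finite W] [DecidableEq W] (F : SimpleGraph W) [F.LocallyFinite] (hc : F.Connected) {d : ℕ}
    (hd : 2 ≤ d) (v : W × Site d) : Continuous fun p : unitInterval => theta (F □ zdGraph d) v p :=
  haveI : Nonempty W := ⟨v.1⟩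
  continuous_theta_boxProdZd F hc (BoxProdZ2.isQuasiTransitive_of_finite F) (BoxProdZ2.not_hasExponentialGrowth_of_finite F) hd v

/-- **`p ↦ θ_{ℤ^d □ F}(v, p)` is continuous on `[0, 1]`** for every finite connected `F`, every `d ≥ 2`, every vertex (the slabs `ℤ^d × {0,…,k}`, `ℤ^d × C_n`, …
at and around their own critical points) — builds on p205010 (kernel theorem, internal audit signed; external expert review pending).
[cite: VandenBergKeane1984, Theorem] [cite: DuminilCopinSidoraviciusTassion2016, §1 ("Two generalizations")] [cite: BenjaminiSchramm1996, Conj. 4] -/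
theorem continuous_theta_zdTimesFinite {W : Type} [Finite W] [DecidableEq W] (F : SimpleGraph W) [F.LocallyFinite] (hc : F.Connected) {d : ℕ}
    (hd : 2 ≤ d) (v : Site d × W) : Continuous fun p : unitInterval => theta (zdGraph d □ F) v p := by
  haveI : Countable (Site d × W) :=
    countable_of_connected_of_locallyFinite (zdGraph d □ F) ((zdGraph_connected d).boxProd hc) v
  haveI : Countable (W × Site d) :=
    countable_of_connected_of_locallyFinite (F □ zdGraph d) (hc.boxProd (zdGraph_connected d)) (v.2, v.1)
  have h := continuous_theta_finiteBoxProdZd F hc hd ((boxProdComm (G := zdGraph d) (H := F)) v)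
  have e : (fun p : unitInterval => theta (F □ zdGraph d) ((boxProdComm (G := zdGraph d) (H := F)) v) p) =
      fun p : unitInterval => theta (zdGraph d □ F) v p := by
    funext p
    exact theta_iso (boxProdComm (G := zdGraph d) (H := F)) v p
  rwa [e] at h

end ThetaCont

end Summit.CriticalPhenomena.PercolationContinuityZ3.Theorems.Transplant

end
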